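import Summits.BirchSwinnertonDyer.Rank1Residual.Additive.N11KimAtThreePUB
import Summits.BirchSwinnertonDyer.Rank1Residual.Additive.N11KimAtThreeDeepPUB
import HarnessLib

/-!
# N11 — Kim-at-3, analytic rank 0, every `t ≤ 2`: the DEEP-LEVEL LOWER CERTIFICATE LANE of the kim3
# CELL THEOREM (memo `kim3/KIM3-PROOF.md` §16 Cor C-t, with §14 (F3)) as a NAME, and its consumer edge
# to `MissingLowerBoundAt W 3`

HONEST FRAMING. Cell `bsd-addord` (run/shared/lean/pub/bsd-addord/). This file NAMES the per-pair LOWER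
lane proved in the memo `kim3/KIM3-PROOF.md` (§16 Corollary C-t and its level-`j` form, from §14 (F1)/(F3)):
for `W/ℚ` with the `3`-adic tower onto, `L(E,1) ≠ 0`, `3^t ≥ #E(ℚ₃)[9]`, a datum `D` with the period
transfer `Ω(W) = u·Ω⁺_{D.f}`, `|u|₃ = 1`, and ONE Kurihara number `δ̃_n ≢ 0 (mod 3^j)` at a cyclic
Kolyvagin level `n ∈ 𝒩_k(E,3)` of depth `k ≥ j + 1 + t`: `ord₃(L(E,1)/Ω(W)) ≤ ord₃ #Ш(E/ℚ)(3) + (j − 1)`.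
At `t = 0` the memo's Cor C gives the same with `k ≥ j` (the all-levels name `KimAtThreeRankZeroPUB`,
`N11KimAtThreePUB.lean`, consumer `missingLowerBoundAt_three_of_kimAtThreeRankZeroPUB_of_indexCert`); the
present name is the `t`-uniform DEEP form (no `E(ℚ₃)[3] = 0` binder; depth `j + 1 + t`), i.e. what the
genuine Kolyvagin system of Kato's optimal Euler system sees at `t ≥ 1` (memo §14.6 (1): nothing at
shallower levels). Compared with the tree's per-pair predicate `KimRankZeroLowerBoundAt W 3`
(`X4SharpThreeKimRefined.lean`: ALL levels `k ≥ j`, Kim 2026 Thm. 1.9 (6) shape, a theorem at `5 ≤ p`,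
ANNOUNCED at `3`) the name is WEAKER (deeper levels only) — the all-levels form at `t ≥ 1` is the memo's
open Conjecture S (§19.5). NOTHING is asserted by the `def`; every theorem below takes the name as an
explicit hypothesis. NOT a Literature fact; the announced record
`Kim2025.thm11_kimShaLength_of_integralPeriod_OPEN` and its flag are untouched.

## Contents
* `KimAtThreeDeepCertPUB` — the name.
* `missingLowerBoundAt_three_of_kimAtThreeDeepCertPUB_of_cert` — granted the name: a deep certificate
  with `j − 1 ≤ ord₃ ∏ c_ℓ` gives `MissingLowerBoundAt W 3` (`ord₃ #Ш_an ≤ ord₃ #Ш`), GZK for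
  `rank = r_an` and the finiteness of `Ш`.
* `missingLowerBoundAt_three_of_kimAtThreeDeepCertPUB_of_unit` — the unit case `j = 1`, `k ≥ 2 + t`:
  ONE unit Kurihara number at a cyclic level `n ∈ 𝒩_{2+t}(E,3)` gives the LOWER half, no Tamagawa
  hypothesis (the planner's T-Ct lane, TARGET.md v4.1 R-Ct / L4.24: `t = 1`, pairs of primes
  `ℓ ≡ 1, a_ℓ ≡ ℓ + 1 (mod 27)`).
* `bsdp_three_of_kimAtThreeDeepCertPUB_of_kimAtThreeDeepPUB_of_unit` (+ `3 ∤ ∏ c_ℓ` ⇒ `BSDp W 3`); the 3-SPLIT lane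
  (memo §19): `KimAtThreeSplitCertPUB`, `missingLowerBoundAt_three_of_kimAtThreeSplitCertPUB_of_unit` / `…_of_cert`, `bsdp_…`.

References: [Kim2025RefinedTNC] Thm. 1.1; [Kim2022StructureSelmer] Thm. 1.9 (6), §1.5.1; [MazurRubin2004]
Prop. A.2, Thm. 5.2.12; [Kato2004Asterisque]; [Sakamoto2024]; [Miller2011LMS] Def. 1.1; memo
`run/shared/lean/pub/bsd-addord/kim3/KIM3-PROOF.md` §14, §16 (and §19 for the split-level variant, not typed here).
-/

noncomputable section

open scoped MatrixGroups ModularForm Classical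

open CongruenceSubgroup WeierstrassCurve Literature.NumberTheory.EllipticCurves
  Literature.NumberTheory.EllipticCurves.ModularForms
  Literature.NumberTheory.EllipticCurves.Kim2025
  Literature.NumberTheory.EllipticCurves.Rank1Residual
  Literature.NumberTheory.EllipticCurves.Rank1Residual.Typed

namespace Summit.BirchSwinnertonDyer.Rank1Residual.Additive.N11

open Summit.BirchSwinnertonDyer.Rank1Residual.X4

/-- **Kim-at-3, rank 0, DEEP-LEVEL LOWER CERTIFICATE (every `t`) — CELL THEOREM of `bsd-addord` seat
kim3** (memo `kim3/KIM3-PROOF.md`, §16 Corollary C-t with §14 Theorem A-t (iii)_t / (F1) / (F3); text of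
record for the score: v2.2, sha256 `fa22ee64825b0d315b5c1a9621a1a7148a2a92d289c2febe1c7c7177552c66c6`;
REFEREE VERDICT `REF … SCORE KIM3-PROOF v2.2: C15 PASS · C16 PASS` (§14, §16), cell bus
`run/shared/lean/pub/bsd-addord/STATUS.md` 2026-08-25T11:02Z and 11:47Z (§18 PASS; v2.3/v2.4 change no scored
argument), report `run/shared/lean/pub/bsd-addord/REF-kim3.md` «REF-kim3-v2» §(iv); the (P) period-transfer
clause of C10-R is DISPLAYED below as the binder `hper`), proved from PUBLISHED inputs [Ka04 + the memo's
Lemma K (optimal integral Euler system at tame 3-abelian levels, C14 PASS); MR04 (H.4)-free items,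
Prop. A.2 (explicit depth `k + t`), Thm. A.4; S24 4.4/5.5/6.7; BK90] + memo lemmas L/L′_t/D_t; NOT a
Literature fact. STATEMENT: for `W/ℚ` globally minimal, the `3`-adic tower onto, `L(E,1) ≠ 0`, `Ш(E/ℚ)`
finite, a parametrisation datum `D` with `Ω(W) = u·Ω⁺_{D.f}`, `|u|₃ = 1`, and natural numbers
`t, j, k` with `#E(ℚ₃)[9] ≤ 3^t`, `1 ≤ j`, `j + 1 + t ≤ k`: if some cyclic Kolyvagin level
`n ∈ 𝒩_k(E,3)` (all `ℓ ∣ n` with `#Ẽ(𝔽_ℓ)[3] ≤ 3`) carries a Kurihara number `δ̃_n ≢ 0 (mod 3^j)`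
(for surjective discrete logarithms `ψ_ℓ : (ℤ/ℓ)ˣ ↠ ℤ/3^j`), then `L(E,1)/Ω(W) = q ∈ ℚ` with
`ord₃ q ≤ ord₃ #Ш(E/ℚ)(3) + (j − 1)`. (The `3`-integrality of the plus symbols of `D.f`, hypothesis (Ω)
of the memo, is the tree theorem `Additive.forall_padicValRat_ratPlusSymbol_nonneg_of_towerSurj` on these
rows and is therefore not displayed; the memo's exponent `e_t ≥ −1` makes depth `j + 1 + t` sufficient for
every `3`-integral period; no Manin-constant hypothesis is used.) A `Prop`; nothing is asserted by the
`def`. [cite: Kim2025RefinedTNC, Thm. 1.1 ("BSD") (PDF p. 5)] [cite: Kim2022StructureSelmer, Thm. 1.9 (6) (PDF p. 8)]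
[cite: MazurRubin2004, Prop. A.2 and Thm. 5.2.12] KERNEL STATUS: an OPEN obligation node (`@[conjecture]`). -/
@[conjecture] def KimAtThreeDeepCertPUB : Prop :=
  ∀ (W : WeierstrassCurve ℚ) [W.IsElliptic] [W.IsGloballyMinimal],
    (∀ n : ℕ, W.HasSurjectiveModNGaloisRep (3 ^ n : ℕ)) →
    W.entireLFunction 1 ≠ 0 → Finite W.sha →
    ∀ {N : ℕ} [NeZero N] (D : ModularParametrizationData W N),
    (∃ u : ℚ, ‖(u : ℚ_[3])‖ = 1 ∧ W.realPeriodRat = u * plusPeriod D.f) →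
    ∀ (t j k n : ℕ) [NeZero n],
      Nat.card {Q : (W.baseChange ℚ_[3]).toAffine.Point // (9 : ℕ) • Q = 0} ≤ 3 ^ t →
      1 ≤ j → j + 1 + t ≤ k → Kato.IsKolyvaginProduct W 3 k n →
      (∀ (ℓ : ℕ) [Fact ℓ.Prime], ℓ ∣ n →
        Nat.card {P : ((WeierstrassCurve.integralModelInt W).map
            (Int.castRingHom (ZMod ℓ))).toAffine.Point // 3 • P = 0} ≤ 3) →
      ∀ ψ : (ℓ : ℕ) → (ZMod ℓ)ˣ →* Multiplicative (ZMod (3 ^ j)),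
        (∀ ℓ ∈ n.primeFactors, Function.Surjective (ψ ℓ)) →
        kuriharaNumber D.f (3 ^ j) n ψ ≠ 0 →
      ∃ q : ℚ, W.entireLFunction 1 / (W.realPeriodRat : ℂ) = (q : ℂ) ∧
        padicValRat 3 q ≤
          (padicValNat 3 (Nat.card (AddCommGroup.primaryComponent W.sha 3)) : ℤ) + ((j - 1 : ℕ) : ℤ)

section Consumers

variable (W : WeierstrassCurve ℚ) [W.IsElliptic] [W.IsGloballyMinimal]

/-- **Granted the name: a DEEP certificate `δ̃_n ≢ 0 (mod 3^j)` at a cyclic level `n ∈ 𝒩_k(E,3)`,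
`k ≥ j + 1 + t`, with `j − 1 ≤ ord₃ ∏ c_ℓ` gives `MissingLowerBoundAt W 3`** (`ord₃ #Ш_an ≤ ord₃ #Ш`):
`ord₃ #Ш_an = ord₃(L/Ω) − ord₃ ∏ c_ℓ ≤ ord₃ #Ш(3) + (j − 1) − ord₃ ∏ c_ℓ ≤ ord₃ #Ш` (GZK `hGZK` for
`rank = r_an` and the finiteness of `Ш`; `3 ∤ #E(ℚ)_tors` from the irreducibility of `E[3]`). The
shape of `missingLowerBoundAt_of_kimLower_of_indexCert` with the depth shifted by `1 + t`.
[cite: Kim2022StructureSelmer, Thm. 1.9 (6), §1.5.1] [cite: Miller2011LMS, Def. 1.1] [cite: Mazur1977, Ch. III §5, p. 157] -/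
theorem missingLowerBoundAt_three_of_kimAtThreeDeepCertPUB_of_cert (hK : KimAtThreeDeepCertPUB)
    (hGZK : rank_eq_analyticRank_of_analyticRank_le_one)
    (htower : ∀ n : ℕ, W.HasSurjectiveModNGaloisRep (3 ^ n : ℕ)) (hL : W.entireLFunction 1 ≠ 0)
    {N : ℕ} [NeZero N] (D : ModularParametrizationData W N)
    (hper : ∃ u : ℚ, ‖(u : ℚ_[3])‖ = 1 ∧ W.realPeriodRat = u * plusPeriod D.f)
    {t j k n : ℕ} [NeZero n]
    (ht : Nat.card {Q : (W.baseChange ℚ_[3]).toAffine.Point // (9 : ℕ) • Q = 0} ≤ 3 ^ t)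
    (hj : 1 ≤ j) (hk : j + 1 + t ≤ k) (hn : Kato.IsKolyvaginProduct W 3 k n)
    (hcyc : ∀ (ℓ : ℕ) [Fact ℓ.Prime], ℓ ∣ n →
      Nat.card {P : ((WeierstrassCurve.integralModelInt W).map
          (Int.castRingHom (ZMod ℓ))).toAffine.Point // 3 • P = 0} ≤ 3)
    (ψ : (ℓ : ℕ) → (ZMod ℓ)ˣ →* Multiplicative (ZMod (3 ^ j)))
    (hψ : ∀ ℓ ∈ n.primeFactors, Function.Surjective (ψ ℓ))
    (hδ : kuriharaNumber D.f (3 ^ j) n ψ ≠ 0) (hjt : j - 1 ≤ padicValNat 3 W.tamagawaProduct) :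
    MissingLowerBoundAt W 3 := by
  haveI : Fact (Nat.Prime 3) := ⟨Nat.prime_three⟩
  have hr0 : W.analyticRank = 0 := analyticRank_eq_zero_of_entireLFunction_one_ne_zero hL
  obtain ⟨hmw, hfin⟩ := hGZK W (by rw [hr0]; exact zero_le_one)
  haveI : Finite W.sha := hfin
  obtain ⟨q₀, hq₀, hle⟩ := hK W htower hL hfin D hper t j k n ht hj hk hn hcyc ψ hψ hδ
  have hq₀0 : q₀ ≠ 0 := rankZero_witness_ne_zero W hL hq₀
  have hirr : W.HasIrreducibleModPGaloisRep 3 :=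
    hasIrreducibleModPGaloisRep_of_hasSurjectiveModNGaloisRep W 3 (by simpa using htower 1)
  refine ⟨q₀ * (W.torsionOrder : ℚ) ^ 2 / (W.tamagawaProduct : ℚ),
    shaAn_eq_of_rankZero_witness W hmw hL hq₀, ?_⟩
  have hsha : padicValNat 3 (Nat.card (AddCommGroup.primaryComponent W.sha 3)) =
      padicValNat 3 W.shaOrder := by
    unfold WeierstrassCurve.shaOrder
    exact padicValNat_card_addPrimaryComponent 3
  have hjt' : ((j - 1 : ℕ) : ℤ) ≤ (padicValNat 3 W.tamagawaProduct : ℤ) := by exact_mod_cast hjt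
  rw [Supersingular.padicValRat_shaAn_witness W 3 hirr hq₀0, ← hsha]
  linarith

/-- **The unit case (the planner's T-Ct lane): granted the name, on a tower row with `L(E,1) ≠ 0`,
`#E(ℚ₃)[9] ≤ 3^t` and a datum with the period transfer, ONE unit Kurihara number `δ̃_n ≢ 0 (mod 3)`
at a cyclic Kolyvagin level `n ∈ 𝒩_{2+t}(E,3)` gives the LOWER half `MissingLowerBoundAt W 3`** —
no Tamagawa hypothesis. (At `t = 1`: pairs of primes `ℓ ≡ 1`, `a_ℓ ≡ ℓ + 1 (mod 27)` with
`#Ẽ(𝔽_ℓ)[3] ≤ 3`; memo §16.) [cite: Kim2025RefinedTNC, Thm. 1.1 ("BSD")] [cite: Miller2011LMS, Def. 1.1] -/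
theorem missingLowerBoundAt_three_of_kimAtThreeDeepCertPUB_of_unit (hK : KimAtThreeDeepCertPUB)
    (hGZK : rank_eq_analyticRank_of_analyticRank_le_one)
    (htower : ∀ n : ℕ, W.HasSurjectiveModNGaloisRep (3 ^ n : ℕ)) (hL : W.entireLFunction 1 ≠ 0)
    {N : ℕ} [NeZero N] (D : ModularParametrizationData W N)
    (hper : ∃ u : ℚ, ‖(u : ℚ_[3])‖ = 1 ∧ W.realPeriodRat = u * plusPeriod D.f)
    {t k n : ℕ} [NeZero n]
    (ht : Nat.card {Q : (W.baseChange ℚ_[3]).toAffine.Point // (9 : ℕ) • Q = 0} ≤ 3 ^ t)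
    (hk : 2 + t ≤ k) (hn : Kato.IsKolyvaginProduct W 3 k n)
    (hcyc : ∀ (ℓ : ℕ) [Fact ℓ.Prime], ℓ ∣ n →
      Nat.card {P : ((WeierstrassCurve.integralModelInt W).map
          (Int.castRingHom (ZMod ℓ))).toAffine.Point // 3 • P = 0} ≤ 3)
    (ψ : (ℓ : ℕ) → (ZMod ℓ)ˣ →* Multiplicative (ZMod (3 ^ 1)))
    (hψ : ∀ ℓ ∈ n.primeFactors, Function.Surjective (ψ ℓ))
    (hδ : kuriharaNumber D.f (3 ^ 1) n ψ ≠ 0) : MissingLowerBoundAt W 3 :=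
  missingLowerBoundAt_three_of_kimAtThreeDeepCertPUB_of_cert W hK hGZK htower hL D hper (j := 1) ht
    le_rfl (by omega) hn hcyc ψ hψ hδ (by simp)

/-- **Granted BOTH cell-theorem names (deep LOWER lane + the deep-limit formula), on a tower row with
`L(E,1) ≠ 0`, `#E(ℚ₃)[9] ≤ 3^t`, a datum with the period transfer and `3 ∤ ∏_ℓ c_ℓ(E)`: ONE unit Kurihara
number at a cyclic Kolyvagin level `n ∈ 𝒩_{2+t}(E,3)` gives `BSD(E,3)`** — LOWER half from
`KimAtThreeDeepCertPUB` (memo §16 Cor C-t), UPPER half `ord₃ #Ш ≤ ord₃(L/Ω⁺_f)` from `KimAtThreeDeepPUB`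
(memo §14 Theorem A-t (ii): a unit at any level kills the all-levels `∂^{(∞)}`), GZK for `rank = r_an` and
`Ш` finite. The `t ≥ 1` counterpart of `bsdp_three_of_kimAtThreeRankZeroPUB_of_kuriharaUnitAt`.
[cite: Kim2025RefinedTNC, Thm. 1.1 ("BSD") and Thm. 1.2 (rk 0)] [cite: Miller2011LMS, Def. 1.1] -/
theorem bsdp_three_of_kimAtThreeDeepCertPUB_of_kimAtThreeDeepPUB_of_unit (hK : KimAtThreeDeepCertPUB)
    (hKD : KimAtThreeDeepPUB) (hGZK : rank_eq_analyticRank_of_analyticRank_le_one)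
    (htower : ∀ n : ℕ, W.HasSurjectiveModNGaloisRep (3 ^ n : ℕ)) (hL : W.entireLFunction 1 ≠ 0)
    {N : ℕ} [NeZero N] (D : ModularParametrizationData W N)
    (hper : ∃ u : ℚ, ‖(u : ℚ_[3])‖ = 1 ∧ W.realPeriodRat = u * plusPeriod D.f)
    {t k n : ℕ} [NeZero n]
    (ht : Nat.card {Q : (W.baseChange ℚ_[3]).toAffine.Point // (9 : ℕ) • Q = 0} ≤ 3 ^ t)
    (hk : 2 + t ≤ k) (hn : Kato.IsKolyvaginProduct W 3 k n)
    (hcyc : ∀ (ℓ : ℕ) [Fact ℓ.Prime], ℓ ∣ n →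
      Nat.card {P : ((WeierstrassCurve.integralModelInt W).map
          (Int.castRingHom (ZMod ℓ))).toAffine.Point // 3 • P = 0} ≤ 3)
    (ψ : (ℓ : ℕ) → (ZMod ℓ)ˣ →* Multiplicative (ZMod (3 ^ 1)))
    (hψ : ∀ ℓ ∈ n.primeFactors, Function.Surjective (ψ ℓ))
    (hδ : kuriharaNumber D.f (3 ^ 1) n ψ ≠ 0) (htam : ¬ 3 ∣ W.tamagawaProduct) : BSDp W 3 := by
  haveI : Fact (Nat.Prime 3) := ⟨Nat.prime_three⟩
  have h32 : (3 : ℕ) ≠ 2 := by norm_num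
  have hr0 : W.analyticRank = 0 := analyticRank_eq_zero_of_entireLFunction_one_ne_zero hL
  obtain ⟨hmw, hfin⟩ := hGZK W (by rw [hr0]; exact zero_le_one)
  haveI : Finite W.sha := hfin
  have hirr : W.HasIrreducibleModPGaloisRep 3 :=
    hasIrreducibleModPGaloisRep_of_hasSurjectiveModNGaloisRep W 3 (by simpa using htower 1)
  -- LOWER half
  have hlow : MissingLowerBoundAt W 3 :=
    missingLowerBoundAt_three_of_kimAtThreeDeepCertPUB_of_unit W hK hGZK htower hL D hper ht hk hn hcyc
      ψ hψ hδ
  -- UPPER half: `ord₃ #Ш(3) ≤ ∂^{(0)}(δ̃) = ord₃ [0]⁺_f = ord₃ (L(E,1)/Ω(W))`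
  have hint := forall_padicValRat_ratPlusSymbol_nonneg_of_towerSurj h32 D.isNewformOf htower
  have hint0 : ¬ 3 ∣ (ratPlusSymbol D.f 0).den :=
    not_dvd_den_of_norm_ratCast_le_one
      (D.isNewformOf.norm_ratPlusSymbol_le_one (x := 0) h32 hirr (by simp))
  have hLeq := D.isNewformOf.entireLFunction_one_eq
  have hne : ratPlusSymbol D.f 0 ≠ 0 := by
    intro h0
    apply hL
    rw [hLeq, h0]
    simp
  have hord : kuriharaVanishingOrder W 3 D.f = 0 :=
    kuriharaVanishingOrder_eq_zero_of_ratPlusSymbol_ne_zero W 3 D.f hint0 hne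
  have hKu : KuriharaUnitAt W 3 D.f :=
    ⟨n, inferInstance, hn.mono (by omega), hcyc, ψ, hψ, hδ⟩
  have hup0 := sha_le_partial_zero_of_kimAtThreeDeepPUB_of_kuriharaUnitAt W hKD htower hfin D.f
    D.isNewformOf hint hord hKu
  rw [kuriharaPartial_zero, kuriharaDivIndex_one_eq W 3 D.f hint0 hne] at hup0
  have hnat : padicValNat 3 (Nat.card (AddCommGroup.primaryComponent W.sha 3)) ≤
      (padicValRat 3 (ratPlusSymbol D.f 0)).toNat := by exact_mod_cast hup0
  have hv0 : 0 ≤ padicValRat 3 (ratPlusSymbol D.f 0) := by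
    unfold padicValRat
    rw [padicValNat.eq_zero_of_not_dvd hint0]
    simp
  have hval : (padicValNat 3 (Nat.card (AddCommGroup.primaryComponent W.sha 3)) : ℤ) ≤
      padicValRat 3 (ratPlusSymbol D.f 0) := by
    have := Int.toNat_of_nonneg hv0
    rw [← this]
    exact_mod_cast hnat
  -- the period transfer: `L(E,1)/Ω(W) = [0]⁺/u`, `ord₃ u = 0`
  obtain ⟨u, hu, hΩ⟩ := hper
  have hu0 : u ≠ 0 := by
    rintro rfl
    rw [Rat.cast_zero, norm_zero] at hu
    exact zero_ne_one hu
  have hΩf : 0 < plusPeriod D.f :=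
    IsNewform0.plusPeriod_pos_holds D.isNewformOf.1 D.isNewformOf.coeffField_eq_bot
  have hq₀ : W.entireLFunction 1 / (W.realPeriodRat : ℂ) = ((ratPlusSymbol D.f 0 / u : ℚ) : ℂ) := by
    rw [hLeq, hΩ]
    have hu' : (u : ℂ) ≠ 0 := by exact_mod_cast hu0
    have hΩf' : ((plusPeriod D.f : ℝ) : ℂ) ≠ 0 := by exact_mod_cast hΩf.ne'
    push_cast
    field_simp
  have hq₀0 : ratPlusSymbol D.f 0 / u ≠ 0 := div_ne_zero hne hu0
  have hsha : padicValNat 3 (Nat.card (AddCommGroup.primaryComponent W.sha 3)) =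
      padicValNat 3 W.shaOrder := by
    unfold WeierstrassCurve.shaOrder
    exact padicValNat_card_addPrimaryComponent 3
  have hup : MissingUpperBoundAt W 3 := by
    refine ⟨ratPlusSymbol D.f 0 / u * (W.torsionOrder : ℚ) ^ 2 / (W.tamagawaProduct : ℚ),
      shaAn_eq_of_rankZero_witness W hmw hL hq₀, ?_⟩
    have hvu : padicValRat 3 u = 0 := by
      have hu0' : (u : ℚ_[3]) ≠ 0 := by
        intro h
        rw [h, norm_zero] at hu
        exact zero_ne_one hu
      have hu1 := hu
      rw [Padic.norm_eq_zpow_neg_valuation hu0', Padic.valuation_ratCast] at hu1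
      have hp1 : (1 : ℝ) < ((3 : ℕ) : ℝ) := by norm_num
      have h := (zpow_eq_one_iff_right₀ (zero_le_one.trans hp1.le) hp1.ne').mp hu1
      linarith
    rw [Supersingular.padicValRat_shaAn_witness W 3 hirr hq₀0, ← hsha,
      padicValRat.div hne hu0, hvu, sub_zero,
      padicValNat.eq_zero_of_not_dvd htam, Nat.cast_zero, sub_zero]
    exact hval
  exact bsdp_of_missingPPartAt W 3 hGZK (by rw [hr0]; exact zero_le_one)
    (missingPPartAt_of_lower_of_upper W 3 hlow hup)

/-! ### The 3-SPLIT lane (memo §19 Theorem S^{spl} / Corollary C-t^{spl}; REF C17 · C18 · C19 PASS) -/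

/-- **Kim-at-3, rank 0, SPLIT-LEVEL LOWER CERTIFICATE (every `t`) — memo §19 Theorem S^{spl} /
Corollary C-t^{spl} (text scored: v2.4 sha256 `e4fc4eb026422f301dcf516909de6463f8c599115e2524b7c86b4d565aa033b2`; current
v2.5 sha256 `64a1ec5c8addbda3020b2b0a89154abcaa16aba0f3ecfb50ffc8026dc73cbdc4` differs by data/locators only; REFEREE VERDICT
`REF … SCORE KIM3-PROOF v2.4 §19: C17 PASS · C18 PASS · C19 PASS ⇒ §19 PASS`, cell bus
`run/shared/lean/pub/bsd-addord/STATUS.md` 2026-08-25T15:1xZ, report `run/shared/lean/pub/bsd-addord/REF-kim3.md` «REF-kim3-v3»;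
pre-audit of this block: REF 15:5xZ), proved from PUBLISHED inputs [Ka04 + Lemma K; MR04 (H.4)-free items + Cor. 4.5.2 on the
split prime set via Lemma Spl (Chebotarev supply under (T) + (Δ-Spl)); S24 4.4/5.5/6.7; BK90] + memo lemmas; NOT a Literature fact.** For `W/ℚ` globally minimal with the
`3`-adic tower onto, `L(E,1) ≠ 0`, `Ш` finite, the discriminant hypothesis (Δ-Spl) `Δ_E ∉ 3ℚ^{×3} ∪ 9ℚ^{×3}`,
a datum `D` with the period transfer, and natural numbers `1 ≤ j`, `j + 1 ≤ k`: if a cyclic Kolyvagin level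
`n ∈ 𝒩_k(E,3)` at which `3` SPLITS COMPLETELY in the `3`-part of `ℚ(μ_n)` (`ord_ℓ(3)` prime to `3` for every
`ℓ ∣ n`) carries `δ̃_n ≢ 0 (mod 3^j)`, then `L(E,1)/Ω(W) = q ∈ ℚ` with `ord₃ q ≤ ord₃ #Ш(E/ℚ)(3) + (j − 1)`
(memo: `e_t ≥ −1`, so depth `j + 1` suffices at every `t`). A `Prop`; nothing asserted.
[cite: Kim2025RefinedTNC, Thm. 1.1 ("BSD")] [cite: Kim2022StructureSelmer, Thm. 3.11 (= v4 Thm. 3.13) and Thm. 1.9 (6)]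
[cite: MazurRubin2004, Cor. 4.5.2] KERNEL STATUS: an OPEN obligation node (`@[conjecture]`). -/
@[conjecture] def KimAtThreeSplitCertPUB : Prop :=
  ∀ (W : WeierstrassCurve ℚ) [W.IsElliptic] [W.IsGloballyMinimal],
    (∀ n : ℕ, W.HasSurjectiveModNGaloisRep (3 ^ n : ℕ)) →
    W.entireLFunction 1 ≠ 0 → Finite W.sha →
    (¬ ∃ c : ℚ, W.Δ = 3 * c ^ 3 ∨ W.Δ = 9 * c ^ 3) →
    ∀ {N : ℕ} [NeZero N] (D : ModularParametrizationData W N),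
    (∃ u : ℚ, ‖(u : ℚ_[3])‖ = 1 ∧ W.realPeriodRat = u * plusPeriod D.f) →
    ∀ (j k n : ℕ) [NeZero n],
      1 ≤ j → j + 1 ≤ k → Kato.IsKolyvaginProduct W 3 k n →
      (∀ (ℓ : ℕ) [Fact ℓ.Prime], ℓ ∣ n →
        Nat.card {P : ((WeierstrassCurve.integralModelInt W).map
            (Int.castRingHom (ZMod ℓ))).toAffine.Point // 3 • P = 0} ≤ 3) →
      (∀ ℓ ∈ n.primeFactors, Nat.Coprime (orderOf (3 : ZMod ℓ)) 3) →
      ∀ ψ : (ℓ : ℕ) → (ZMod ℓ)ˣ →* Multiplicative (ZMod (3 ^ j)),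
        (∀ ℓ ∈ n.primeFactors, Function.Surjective (ψ ℓ)) →
        kuriharaNumber D.f (3 ^ j) n ψ ≠ 0 →
      ∃ q : ℚ, W.entireLFunction 1 / (W.realPeriodRat : ℂ) = (q : ℂ) ∧
        padicValRat 3 q ≤
          (padicValNat 3 (Nat.card (AddCommGroup.primaryComponent W.sha 3)) : ℤ) + ((j - 1 : ℕ) : ℤ)

/-- **Granted the split name: ONE unit Kurihara number at a 3-split cyclic level `n ∈ 𝒩_2(E,3)` gives
`MissingLowerBoundAt W 3`** on a tower row with `L(E,1) ≠ 0`, (Δ-Spl) and a datum with the period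
transfer — every `t`, no Tamagawa hypothesis (memo §19.4). [cite: Kim2025RefinedTNC, Thm. 1.1 ("BSD")] [cite: Miller2011LMS, Def. 1.1] -/
theorem missingLowerBoundAt_three_of_kimAtThreeSplitCertPUB_of_unit (hK : KimAtThreeSplitCertPUB)
    (hGZK : rank_eq_analyticRank_of_analyticRank_le_one)
    (htower : ∀ n : ℕ, W.HasSurjectiveModNGaloisRep (3 ^ n : ℕ)) (hL : W.entireLFunction 1 ≠ 0)
    (hΔ : ¬ ∃ c : ℚ, W.Δ = 3 * c ^ 3 ∨ W.Δ = 9 * c ^ 3)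
    {N : ℕ} [NeZero N] (D : ModularParametrizationData W N)
    (hper : ∃ u : ℚ, ‖(u : ℚ_[3])‖ = 1 ∧ W.realPeriodRat = u * plusPeriod D.f)
    {k n : ℕ} [NeZero n] (hk : 2 ≤ k) (hn : Kato.IsKolyvaginProduct W 3 k n)
    (hcyc : ∀ (ℓ : ℕ) [Fact ℓ.Prime], ℓ ∣ n →
      Nat.card {P : ((WeierstrassCurve.integralModelInt W).map
          (Int.castRingHom (ZMod ℓ))).toAffine.Point // 3 • P = 0} ≤ 3)
    (hspl : ∀ ℓ ∈ n.primeFactors, Nat.Coprime (orderOf (3 : ZMod ℓ)) 3)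
    (ψ : (ℓ : ℕ) → (ZMod ℓ)ˣ →* Multiplicative (ZMod (3 ^ 1)))
    (hψ : ∀ ℓ ∈ n.primeFactors, Function.Surjective (ψ ℓ))
    (hδ : kuriharaNumber D.f (3 ^ 1) n ψ ≠ 0) : MissingLowerBoundAt W 3 := by
  haveI : Fact (Nat.Prime 3) := ⟨Nat.prime_three⟩
  have hr0 : W.analyticRank = 0 := analyticRank_eq_zero_of_entireLFunction_one_ne_zero hL
  obtain ⟨hmw, hfin⟩ := hGZK W (by rw [hr0]; exact zero_le_one)
  haveI : Finite W.sha := hfin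
  obtain ⟨q₀, hq₀, hle⟩ := hK W htower hL hfin hΔ D hper 1 k n le_rfl (by omega) hn hcyc hspl ψ hψ hδ
  have hq₀0 : q₀ ≠ 0 := rankZero_witness_ne_zero W hL hq₀
  have hirr : W.HasIrreducibleModPGaloisRep 3 :=
    hasIrreducibleModPGaloisRep_of_hasSurjectiveModNGaloisRep W 3 (by simpa using htower 1)
  refine ⟨q₀ * (W.torsionOrder : ℚ) ^ 2 / (W.tamagawaProduct : ℚ),
    shaAn_eq_of_rankZero_witness W hmw hL hq₀, ?_⟩
  have hsha : padicValNat 3 (Nat.card (AddCommGroup.primaryComponent W.sha 3)) =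
      padicValNat 3 W.shaOrder := by
    unfold WeierstrassCurve.shaOrder
    exact padicValNat_card_addPrimaryComponent 3
  rw [Supersingular.padicValRat_shaAn_witness W 3 hirr hq₀0, ← hsha]
  simp only [Nat.sub_self, Nat.cast_zero, add_zero] at hle
  have h0 : (0 : ℤ) ≤ (padicValNat 3 W.tamagawaProduct : ℤ) := by exact_mod_cast Nat.zero_le _
  linarith

/-- **Granted the split name: a level-`j` certificate `δ̃_n ≢ 0 (mod 3^j)` at a 3-split cyclic level
`n ∈ 𝒩_k(E,3)`, `k ≥ j + 1`, with `j − 1 ≤ ord₃ ∏ c_ℓ` gives `MissingLowerBoundAt W 3`** (tower, `L(E,1) ≠ 0`,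
(Δ-Spl), datum with the period transfer; every `t`; memo §19.4 level-`j` reading) — the split twin of
`missingLowerBoundAt_three_of_kimAtThreeDeepCertPUB_of_cert` (depth `j + 1` in place of `j + 1 + t`).
[cite: Kim2025RefinedTNC, Thm. 1.1 ("BSD")] [cite: Kim2022StructureSelmer, Thm. 1.9 (6)] [cite: Miller2011LMS, Def. 1.1] -/
theorem missingLowerBoundAt_three_of_kimAtThreeSplitCertPUB_of_cert (hK : KimAtThreeSplitCertPUB)
    (hGZK : rank_eq_analyticRank_of_analyticRank_le_one)
    (htower : ∀ n : ℕ, W.HasSurjectiveModNGaloisRep (3 ^ n : ℕ)) (hL : W.entireLFunction 1 ≠ 0)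
    (hΔ : ¬ ∃ c : ℚ, W.Δ = 3 * c ^ 3 ∨ W.Δ = 9 * c ^ 3)
    {N : ℕ} [NeZero N] (D : ModularParametrizationData W N)
    (hper : ∃ u : ℚ, ‖(u : ℚ_[3])‖ = 1 ∧ W.realPeriodRat = u * plusPeriod D.f)
    {j k n : ℕ} [NeZero n] (hj : 1 ≤ j) (hk : j + 1 ≤ k) (hn : Kato.IsKolyvaginProduct W 3 k n)
    (hcyc : ∀ (ℓ : ℕ) [Fact ℓ.Prime], ℓ ∣ n →
      Nat.card {P : ((WeierstrassCurve.integralModelInt W).map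
          (Int.castRingHom (ZMod ℓ))).toAffine.Point // 3 • P = 0} ≤ 3)
    (hspl : ∀ ℓ ∈ n.primeFactors, Nat.Coprime (orderOf (3 : ZMod ℓ)) 3)
    (ψ : (ℓ : ℕ) → (ZMod ℓ)ˣ →* Multiplicative (ZMod (3 ^ j)))
    (hψ : ∀ ℓ ∈ n.primeFactors, Function.Surjective (ψ ℓ))
    (hδ : kuriharaNumber D.f (3 ^ j) n ψ ≠ 0) (hjt : j - 1 ≤ padicValNat 3 W.tamagawaProduct) :
    MissingLowerBoundAt W 3 := by
  haveI : Fact (Nat.Prime 3) := ⟨Nat.prime_three⟩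
  have hr0 : W.analyticRank = 0 := analyticRank_eq_zero_of_entireLFunction_one_ne_zero hL
  obtain ⟨hmw, hfin⟩ := hGZK W (by rw [hr0]; exact zero_le_one)
  haveI : Finite W.sha := hfin
  obtain ⟨q₀, hq₀, hle⟩ := hK W htower hL hfin hΔ D hper j k n hj hk hn hcyc hspl ψ hψ hδ
  have hirr := hasIrreducibleModPGaloisRep_of_hasSurjectiveModNGaloisRep W 3 (by simpa using htower 1)
  refine ⟨_, shaAn_eq_of_rankZero_witness W hmw hL hq₀, ?_⟩
  have hjt' : ((j - 1 : ℕ) : ℤ) ≤ (padicValNat 3 W.tamagawaProduct : ℤ) := by exact_mod_cast hjt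
  rw [Supersingular.padicValRat_shaAn_witness W 3 hirr (rankZero_witness_ne_zero W hL hq₀),
    WeierstrassCurve.shaOrder, ← padicValNat_card_addPrimaryComponent (A := W.sha) 3]
  linarith

/-- **Granted the SPLIT name and the deep-limit formula: tower, `L(E,1) ≠ 0`, (Δ-Spl), a datum with the
period transfer, `3 ∤ ∏_ℓ c_ℓ(E)`, and ONE unit Kurihara number at a 3-split cyclic level `n ∈ 𝒩_2(E,3)`
⇒ `BSD(E,3)`**, every `t`: LOWER half from `KimAtThreeSplitCertPUB` (memo §19 Cor C-t^{spl}), UPPER half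
from `KimAtThreeDeepPUB` (`missingUpperBoundAt_three_of_kimAtThreeDeepPUB_of_kuriharaUnitAt`: a unit at
any level kills the all-levels `∂^{(∞)}`), GZK. The split twin (depth `2`, not `2 + t`) of the deep lane's
`bsdp_three_of_kimAtThreeDeepCertPUB_of_kimAtThreeDeepPUB_of_unit`. [cite: Kim2025RefinedTNC, Thm. 1.2 (rk 0)] [cite: Miller2011LMS, Def. 1.1] -/
theorem bsdp_three_of_kimAtThreeSplitCertPUB_of_kimAtThreeDeepPUB_of_unit (hK : KimAtThreeSplitCertPUB)
    (hKD : KimAtThreeDeepPUB) (hGZK : rank_eq_analyticRank_of_analyticRank_le_one)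
    (htower : ∀ n : ℕ, W.HasSurjectiveModNGaloisRep (3 ^ n : ℕ)) (hL : W.entireLFunction 1 ≠ 0)
    (hΔ : ¬ ∃ c : ℚ, W.Δ = 3 * c ^ 3 ∨ W.Δ = 9 * c ^ 3)
    {N : ℕ} [NeZero N] (D : ModularParametrizationData W N)
    (hper : ∃ u : ℚ, ‖(u : ℚ_[3])‖ = 1 ∧ W.realPeriodRat = u * plusPeriod D.f)
    {k n : ℕ} [NeZero n] (hk : 2 ≤ k) (hn : Kato.IsKolyvaginProduct W 3 k n)
    (hcyc : ∀ (ℓ : ℕ) [Fact ℓ.Prime], ℓ ∣ n →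
      Nat.card {P : ((WeierstrassCurve.integralModelInt W).map
          (Int.castRingHom (ZMod ℓ))).toAffine.Point // 3 • P = 0} ≤ 3)
    (hspl : ∀ ℓ ∈ n.primeFactors, Nat.Coprime (orderOf (3 : ZMod ℓ)) 3)
    (ψ : (ℓ : ℕ) → (ZMod ℓ)ˣ →* Multiplicative (ZMod (3 ^ 1)))
    (hψ : ∀ ℓ ∈ n.primeFactors, Function.Surjective (ψ ℓ))
    (hδ : kuriharaNumber D.f (3 ^ 1) n ψ ≠ 0) (htam : ¬ 3 ∣ W.tamagawaProduct) : BSDp W 3 := by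
  haveI : Fact (Nat.Prime 3) := ⟨Nat.prime_three⟩
  have hKu : KuriharaUnitAt W 3 D.f := ⟨n, inferInstance, hn.mono (by omega), hcyc, ψ, hψ, hδ⟩
  exact bsdp_of_missingPPartAt W 3 hGZK
    (by rw [analyticRank_eq_zero_of_entireLFunction_one_ne_zero hL]; exact zero_le_one)
    (missingPPartAt_of_lower_of_upper W 3
      (missingLowerBoundAt_three_of_kimAtThreeSplitCertPUB_of_unit W hK hGZK htower hL hΔ D hper hk hn
        hcyc hspl ψ hψ hδ)
      (missingUpperBoundAt_three_of_kimAtThreeDeepPUB_of_kuriharaUnitAt W hKD hGZK htower hL D hper hKu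
        htam))

end Consumers

end Summit.BirchSwinnertonDyer.Rank1Residual.Additive.N11

end
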